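import Literature.Barriers.QuantumAdvantage.BoundedEntanglementSplitting
import HarnessLib

/-!
# Configurations supported on a set of wires and the product structure of register sums

Topic `Literature/Barriers/QuantumAdvantage`; infrastructure file of the proof programme for the
named fact `Literature.Barriers.QuantumAdvantage.jozsaLinden2003_pblocked` (Jozsa–Linden 2003,
§3). The classical description of a `p`-blocked state lists, block by block, data indexed by the
configurations *of the block* ("for each block we give its state by listing the amplitudes in the
computational basis", proof of lemma `ratpbl`, (b)); partial traces and norms are sums over the
configurations of the complementary wires. On the catalogue's register `QReg N = Fin N → Bool`
we keep everything on the full register (no subtypes) and represent a configuration of the wires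
`X` by the register configuration supported inside `X`:

* `zeroCfg N` — the all-`false` configuration; `cfg X` — the configurations vanishing off `X`
  (`mem_cfg`), with the projection `proj X` (`proj_mem_cfg`, `proj_eq_self_of_mem_cfg`);
* **`sum_cfg_eq_sum_sum`** — for `X ⊆ Z`, a sum over the configurations of `Z` is the double
  sum over the configurations of `X` and of `Z \ X`, glued by `Finset.piecewise` (the bijection
  `{0,1}^Z ≃ {0,1}^X × {0,1}^{Z∖X}`); the instances `sum_eq_sum_cfg_sum_cfg` (the whole register
  against `X` and `Xᶜ`, i.e. Fubini along `X`) and `sum_eq_card_cfg_smul_sum_cfg` (a summand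
  blind to the wires of `X` is counted `#cfg X` times);
* `cfg_singleton`, `card_cfg` (`#cfg X = 2 ^ #X`), `card_cfg_pos`, `zeroCfg_mem_cfg`.

## References

* R. Jozsa, N. Linden, *On the role of entanglement in quantum-computational speed-up*, Proc. R.
  Soc. Lond. A 459 (2003) 2011–2032, arXiv:quant-ph/0201143: §3, proof of lemma `ratpbl`
  ((a), (b): the block description; Case 2: reduced states of subsets).
* M. A. Nielsen, I. L. Chuang, *Quantum Computation and Quantum Information*, CUP 2010, §2.4.3
  (reduced density operator, partial trace as a sum over a basis of the traced-out factor).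
-/

namespace Literature.Barriers.QuantumAdvantage

open Finset Literature.Computability.Cryptography

variable {N : ℕ}

/-! ### Configurations supported on a set of wires -/

/-- The all-`false` register configuration. [folklore] -/
def zeroCfg (N : ℕ) : QReg N := fun _ => false

/-- The value of the zero configuration. [folklore] -/
@[simp] theorem zeroCfg_apply (i : Fin N) : zeroCfg N i = false := rfl

/-- `cfg X`: the register configurations supported inside the wire set `X` (all wires outside
`X` read `false`) — our representation of "the configurations of the qubits in `X`".
[cite: JozsaLinden2003, §3 (proof of lemma ratpbl, (b) block states)] -/
def cfg (X : Finset (Fin N)) : Finset (QReg N) :=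
  univ.filter fun r => ∀ i, i ∉ X → r i = false

/-- Membership in `cfg X`. [folklore] -/
theorem mem_cfg {X : Finset (Fin N)} {r : QReg N} : r ∈ cfg X ↔ ∀ i, i ∉ X → r i = false := by
  simp [cfg]

/-- The zero configuration is supported everywhere. [folklore] -/
theorem zeroCfg_mem_cfg (X : Finset (Fin N)) : zeroCfg N ∈ cfg X :=
  mem_cfg.2 fun _ _ => rfl

/-- `cfg X` is nonempty. [folklore] -/
theorem card_cfg_pos (X : Finset (Fin N)) : 0 < (cfg X).card :=
  card_pos.2 ⟨zeroCfg N, zeroCfg_mem_cfg X⟩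

/-- Every configuration is supported inside the full wire set. [folklore] -/
@[simp] theorem cfg_univ : cfg (univ : Finset (Fin N)) = univ := by
  ext r
  simp [mem_cfg]

/-- `cfg` is monotone. [folklore] -/
theorem cfg_mono {X Y : Finset (Fin N)} (h : X ⊆ Y) : cfg X ⊆ cfg Y :=
  fun _ hr => mem_cfg.2 fun i hi => mem_cfg.1 hr i fun hiX => hi (h hiX)

/-- `proj X r`: the configuration `r` restricted to `X` (zero elsewhere). [folklore] -/
def proj (X : Finset (Fin N)) (r : QReg N) : QReg N := X.piecewise r (zeroCfg N)

/-- The projection to `X` is supported inside `X`. [folklore] -/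
theorem proj_mem_cfg (X : Finset (Fin N)) (r : QReg N) : proj X r ∈ cfg X :=
  mem_cfg.2 fun i hi => by rw [proj, piecewise_eq_of_notMem _ _ _ hi, zeroCfg_apply]

/-- On its wires the projection agrees with the configuration. [folklore] -/
theorem proj_apply_of_mem {X : Finset (Fin N)} (r : QReg N) {i : Fin N} (hi : i ∈ X) :
    proj X r i = r i :=
  piecewise_eq_of_mem _ _ _ hi

/-- Off its wires the projection vanishes. [folklore] -/
theorem proj_apply_of_notMem {X : Finset (Fin N)} (r : QReg N) {i : Fin N} (hi : i ∉ X) :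
    proj X r i = false := by
  rw [proj, piecewise_eq_of_notMem _ _ _ hi, zeroCfg_apply]

/-- A configuration supported inside `X` is its own projection. [folklore] -/
theorem proj_eq_self_of_mem_cfg {X : Finset (Fin N)} {r : QReg N} (hr : r ∈ cfg X) : proj X r = r := by
  funext i
  by_cases hi : i ∈ X
  · exact proj_apply_of_mem r hi
  · rw [proj_apply_of_notMem r hi, mem_cfg.1 hr i hi]

/-- Gluing any configuration along `X ⊆ Z` onto a configuration of `Z \ X` gives a
configuration of `Z`. [folklore] -/
theorem piecewise_mem_cfg {X Z : Finset (Fin N)} (hXZ : X ⊆ Z) (s : QReg N) {t : QReg N}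
    (ht : t ∈ cfg (Z \ X)) : X.piecewise s t ∈ cfg Z := by
  refine mem_cfg.2 fun i hi => ?_
  have hiX : i ∉ X := fun h => hi (hXZ h)
  rw [piecewise_eq_of_notMem _ _ _ hiX]
  exact mem_cfg.1 ht i fun h => hi (mem_sdiff.1 h).1

/-! ### Product structure of sums over configurations -/

/-- **`{0,1}^Z ≃ {0,1}^X × {0,1}^{Z∖X}` for sums.** For `X ⊆ Z`, summing over the configurations
of `Z` is summing over a configuration of `X` glued with a configuration of `Z \ X`.
[cite: NielsenChuang2010, §2.4.3 (sums over a product basis)] -/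
theorem sum_cfg_eq_sum_sum {M : Type*} [AddCommMonoid M] {X Z : Finset (Fin N)} (hXZ : X ⊆ Z)
    (Φ : QReg N → M) :
    ∑ r ∈ cfg Z, Φ r = ∑ s ∈ cfg X, ∑ t ∈ cfg (Z \ X), Φ (X.piecewise s t) := by
  rw [← Finset.sum_product']
  symm
  refine Finset.sum_nbij' (fun p => X.piecewise p.1 p.2) (fun r => (proj X r, proj (Z \ X) r))
    ?_ ?_ ?_ ?_ ?_
  · rintro ⟨s, t⟩ hp
    exact piecewise_mem_cfg hXZ s (Finset.mem_product.1 hp).2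
  · intro r _
    exact Finset.mem_product.2 ⟨proj_mem_cfg _ _, proj_mem_cfg _ _⟩
  · rintro ⟨s, t⟩ hp
    obtain ⟨hs, ht⟩ := Finset.mem_product.1 hp
    refine Prod.ext ?_ ?_
    · change proj X (X.piecewise s t) = s
      funext i
      by_cases hi : i ∈ X
      · rw [proj_apply_of_mem _ hi, piecewise_eq_of_mem _ _ _ hi]
      · rw [proj_apply_of_notMem _ hi]
        exact (mem_cfg.1 hs i hi).symm
    · change proj (Z \ X) (X.piecewise s t) = t
      funext i
      by_cases hi : i ∈ Z \ X
      · rw [proj_apply_of_mem _ hi, piecewise_eq_of_notMem _ _ _ (mem_sdiff.1 hi).2]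
      · rw [proj_apply_of_notMem _ hi]
        exact (mem_cfg.1 ht i hi).symm
  · intro r hr
    change X.piecewise (proj X r) (proj (Z \ X) r) = r
    funext i
    by_cases hi : i ∈ X
    · rw [piecewise_eq_of_mem _ _ _ hi, proj_apply_of_mem _ hi]
    · rw [piecewise_eq_of_notMem _ _ _ hi]
      by_cases hiZ : i ∈ Z
      · exact proj_apply_of_mem _ (mem_sdiff.2 ⟨hiZ, hi⟩)
      · rw [proj_apply_of_notMem _ (fun h => hiZ (mem_sdiff.1 h).1), mem_cfg.1 hr i hiZ]
  · intro p _
    rfl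

/-- **Fubini along a wire set**: summing over the whole register is summing over a configuration
of `Xᶜ` and a configuration of `X`, glued along `X`.
[cite: NielsenChuang2010, §2.4.3 (sums over a product basis)] -/
theorem sum_eq_sum_cfg_sum_cfg {M : Type*} [AddCommMonoid M] (X : Finset (Fin N)) (Φ : QReg N → M) :
    ∑ w, Φ w = ∑ r ∈ cfg Xᶜ, ∑ s ∈ cfg X, Φ (X.piecewise s r) := by
  rw [← cfg_univ, sum_cfg_eq_sum_sum (subset_univ X) Φ, Finset.sum_comm]
  simp only [sdiff_eq_inter_compl, univ_inter]

/-- A summand blind to the wires of `X` is counted `#cfg X` times: if `Φ (X.piecewise s r) = Φ r`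
for all `s`, then `∑_w Φ w = #cfg X • ∑_{r ∈ cfg Xᶜ} Φ r`. [folklore] -/
theorem sum_eq_card_cfg_smul_sum_cfg {M : Type*} [AddCommMonoid M] (X : Finset (Fin N))
    (Φ : QReg N → M) (hΦ : ∀ s r, Φ (X.piecewise s r) = Φ r) :
    ∑ w, Φ w = (cfg X).card • ∑ r ∈ cfg Xᶜ, Φ r := by
  rw [sum_eq_sum_cfg_sum_cfg X Φ, Finset.smul_sum]
  refine Finset.sum_congr rfl fun r _ => ?_
  rw [Finset.sum_congr rfl fun s _ => hΦ s r, Finset.sum_const]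

/-! ### Counting configurations -/

/-- The configurations of a single wire: all-`false`, or `true` exactly on that wire. [folklore] -/
theorem cfg_singleton (i : Fin N) :
    cfg ({i} : Finset (Fin N)) = {zeroCfg N, Function.update (zeroCfg N) i true} := by
  ext r
  rw [mem_cfg, mem_insert, mem_singleton]
  constructor
  · intro h
    by_cases hi : r i = true
    · refine Or.inr (funext fun j => ?_)
      by_cases hj : j = i
      · subst hj
        rw [Function.update_self, hi]
      · rw [Function.update_of_ne hj, zeroCfg_apply, h j (by simpa using hj)]
    · refine Or.inl (funext fun j => ?_)
      by_cases hj : j = i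
      · subst hj
        simpa using hi
      · rw [zeroCfg_apply, h j (by simpa using hj)]
  · rintro (rfl | rfl) j hj
    · rfl
    · rw [Function.update_of_ne (by simpa using hj), zeroCfg_apply]

/-- **`#cfg X = 2 ^ #X`.** [folklore] -/
theorem card_cfg (X : Finset (Fin N)) : (cfg X).card = 2 ^ X.card := by
  induction X using Finset.induction_on with
  | empty =>
    rw [card_empty, pow_zero, card_eq_one]
    refine ⟨zeroCfg N, ?_⟩
    ext r
    rw [mem_cfg, mem_singleton]
    exact ⟨fun h => funext fun j => h j (notMem_empty j), fun h j _ => by rw [h, zeroCfg_apply]⟩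
  | insert i X hi ih =>
    have hsub : ({i} : Finset (Fin N)) ⊆ insert i X := by simp
    have hsd : insert i X \ {i} = X := by
      rw [insert_sdiff_of_mem _ (mem_singleton_self i), sdiff_singleton_eq_erase, erase_eq_of_notMem hi]
    rw [card_eq_sum_ones, sum_cfg_eq_sum_sum hsub, hsd]
    simp only [sum_const, smul_eq_mul, mul_one, ih, cfg_singleton, card_insert_of_notMem hi,
      pow_succ]
    rw [card_pair]
    · ring
    · intro h0
      have := congrFun h0 i
      simp at this

/-! ### Gluing algebra used by the reduced-state formulas -/

variable {S T C A : Finset (Fin N)}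

/-- Gluing `x` along `S` onto (`x` along `T` onto `w`) is gluing `x` along `S ∪ T` onto `w`,
whatever configuration `r` sat under `x` on `S`: `S.piecewise (S.piecewise x r) (T.piecewise x w)`
equals `(S ∪ T).piecewise x w` (no disjointness needed). [folklore] -/
theorem piecewise_piecewise_piecewise_eq_piecewise_union (x r w : QReg N) :
    S.piecewise (S.piecewise x r) (T.piecewise x w) = (S ∪ T).piecewise x w := by
  funext i
  by_cases hS : i ∈ S <;> by_cases hT : i ∈ T <;> simp [Finset.piecewise, hS, hT]

/-- For disjoint `S`, `T`: seen through `Sᶜ`, gluing (`x` along `T` onto `S.piecewise s u`) with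
(`x` along `S` onto `r`) is `S.piecewise s r`. [folklore] -/
theorem piecewise_piecewise_piecewise_of_disjoint (hST : Disjoint S T) (x r s u : QReg N) :
    S.piecewise (T.piecewise x (S.piecewise s u)) (S.piecewise x r) = S.piecewise s r := by
  funext i
  by_cases hS : i ∈ S
  · have hT : i ∉ T := Finset.disjoint_left.1 hST hS
    simp [Finset.piecewise, hS, hT]
  · simp [Finset.piecewise, hS]

/-- Gluing along `S ∪ T` only sees the outer configuration off `S ∪ T`: replacing it on `S` is
harmless. [folklore] -/
theorem piecewise_union_piecewise_right (x s u : QReg N) :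
    (S ∪ T).piecewise x (S.piecewise s u) = (S ∪ T).piecewise x u := by
  funext i
  by_cases hS : i ∈ S <;> by_cases hT : i ∈ T <;> simp [Finset.piecewise, hS, hT]

/-- For `A ⊆ C`: gluing `x` along `A` onto (`t` along `C \ A` onto `r`) is gluing
(`t` along `C \ A` onto `x`) along `C` onto `r`. [folklore] -/
theorem piecewise_piecewise_sdiff_eq (hAC : A ⊆ C) (x t r : QReg N) :
    A.piecewise x ((C \ A).piecewise t r) = C.piecewise ((C \ A).piecewise t x) r := by
  funext i
  by_cases hA : i ∈ A
  · have hC : i ∈ C := hAC hA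
    simp [Finset.piecewise, hA, hC]
  · by_cases hC : i ∈ C <;> simp [Finset.piecewise, hA, hC]

/-- For `A ⊆ C`: `Aᶜ \ (C \ A) = Cᶜ`. [folklore] -/
theorem compl_sdiff_sdiff_eq (hAC : A ⊆ C) : Aᶜ \ (C \ A) = Cᶜ := by
  ext i
  simp only [mem_sdiff, mem_compl, not_and, not_not]
  constructor
  · rintro ⟨hA, h⟩ hC
    exact hA (h hC)
  · intro hC
    exact ⟨fun hA => hC (hAC hA), fun hC' => absurd hC' hC⟩

/-- `Tᶜ \ S = (S ∪ T)ᶜ`. [folklore] -/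
theorem compl_sdiff_eq_compl_union : Tᶜ \ S = (S ∪ T)ᶜ := by
  ext i
  simp only [mem_sdiff, mem_compl, mem_union, not_or]
  tauto

end Literature.Barriers.QuantumAdvantage
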